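import Summits.Ventures.YMGap.RobustBall.KernelClusteringBall
import Summits.Ventures.YMGap.RobustBall.ConcentrationKR
import Summits.Ventures.YMGap.RobustBall.UniformPlaquetteSusceptibility
import Summits.Ventures.YMGap.RobustBall.WalkTranslation
import Summits.Ventures.YMGap.RobustBall.OneStateBoundary
import Summits.Ventures.YMGap.RobustBall.BoundaryDecayTorus
import Mathlib.Analysis.Normed.Group.Tannery
import HarnessLib

/-!
# Venture YMGap, track ROBUST-BALL — C-KMIX (V′): block sums of ANY local Lipschitz observable under the finite-volume kernels — a variance
# ceiling uniform in the volume and the boundary field, and the thermodynamic limit of their susceptibility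

HONEST FRAMING. WHAT THIS IS: a venture file (cell `pub-ymgap`, track Y2 ROBUST-BALL, seat ds-3, theorems only), the extension of
`KernelSusceptibility.lean` (plaquette sums) to block sums `Σ_{x∈B} F∘θ_x` of the translates of an ARBITRARY Lipschitz cylinder observable
`F` (links `Δ`, constant `K`, `|F| ≤ M`, base points of `Δ` within sup-distance `D` of each other). GENERIC: if a family of probability measures
`γ Λ η` clusters uniformly, `|cov_{γ Λ η}(F₁, F₂)| ≤ A · #Λ₁ · #Λ₂ · K₁K₂ · e^{−m d(Λ₁,Λ₂)}`, then (`kernel_abs_cov_shift_le`,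
`kernel_variance_blockSum_le`) for every `Λ`, `η`, every finite `B ⊆ ℤ^d` and every `x`:
  `|cov_{γ Λ η}(F∘θ_x, F∘θ_y)| ≤ v₀ (e^{−m/d})^{‖x−y‖₁}`,  `Σ_{y∈B} |cov_{γ Λ η}(F∘θ_x, F∘θ_y)| ≤ v`,  `Var_{γ Λ η}(Σ_{x∈B} F∘θ_x) ≤ v · #B`,
  `v₀ = A · #Δ² · K² · e^{mD}`, `v = v₀ · ((1 + e^{−m/d})/(1 − e^{−m/d}))^d` — ONE variance density for ALL volumes, boundary fields and blocks
(the finite-volume, boundary-uniform companion of `ThermodynamicVariance.tendsto_variance_boxSum_div`); and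
(`tendsto_tsum_cov_shift_of_clustering`) if moreover the kernels converge on bounded continuous observables along `(Λ_n, η_n)` to a
probability measure `μ`, then `Σ_y cov_{γ_{Λ_n}(·|η_n)}(F∘θ_x, F∘θ_y) → Σ_y cov_μ(F∘θ_x, F∘θ_y)` (Tannery). CARRIER
(`kernel_blockVariance_of_isKRContraction`): every member of the tier-1 ball in any KR door. CELLS: `SU(2)` on `ℤ⁴`, `0 ≤ β_W ≤ 1/12`,
`A = 32`, `m = log 2` (`su2_wilson_kernel_blockVariance_upTo_oneTwelfth`; Wilson loops `c·W_γ`, base-point spread `2|γ|` of their links by the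
tree's `norm_sub_le_two_mul_length_of_mem_walkEdges`: `su2_wilson_kernel_loop_blockVariance_upTo_oneTwelfth`; the thermodynamic limit for
every exhausting `Λ_n` and EVERY boundary sequence `η_n`: `su2_wilson_kernel_observable_susceptibility_tendsto`).
MECHANISM: `isLipschitzCylinder_comp_configShift` (g13), `norm_sub_le_setDistEdges_shift`, rb-p1's `exp_neg_norm_le_pow` and `ℓ¹` lattice sum
`Σ_y r^{‖x − y‖₁} ≤ ((1+r)/(1−r))^d`, Mathlib `covariance_sum_sum'` and `tendsto_tsum_of_dominated_convergence`.
WHAT THIS IS NOT: inside the single-link doors only; the variance density is an upper bound (the limit statement is for the susceptibility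
series, not for Var/#B along growing blocks); lattice strong coupling; nothing about the continuum limit or the Clay problem.

References: B. Simon, *The Statistical Mechanics of Lattice Gases* I (1993), §III.1; R. L. Dobrushin, S. B. Shlosman (1985) (finite-volume
mixing); the tree's `KernelClusteringBall.lean`, `KernelSusceptibility.lean`, `LatticeSumL1.lean`, `OneStateBoundary.lean`.
-/

noncomputable section
open MeasureTheory Filter Function ProbabilityTheory Real Topology
open scoped NNReal
open Literature.Probability.LatticeModels
open Literature.Probability.LatticeModels.DobrushinMetric
open Literature.MathematicalPhysics.QuantumLattice
open Literature.MathematicalPhysics.QuantumFieldTheory hiding ZdEdge Site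

namespace Summit.Ventures.YMGap.RobustBall
namespace KernelBlockVariance

variable {d N : ℕ}

/-! ### Geometry of translated supports -/

/-- **Two translates of a link set are far apart when the translation vectors are**: if the base points of `Δ` are within sup-distance
`D` of each other, the edge-set distance of `Δ − x` and `Δ − y` is `≥ ‖x − y‖_∞ − D`. [folklore] -/
theorem norm_sub_le_setDistEdges_shift {Δ : Finset (ZdEdge d)} (hΔ : Δ.Nonempty) {D : ℝ}
    (hD : ∀ e ∈ Δ, ∀ e' ∈ Δ, ‖e.1 - e'.1‖ ≤ D) (x y : Site d) :
    ‖x - y‖ - D ≤ setDistEdges (Δ.image fun e => (e.1 - x, e.2)) (Δ.image fun e => (e.1 - y, e.2)) := by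
  classical
  refine le_setDistEdges_of_forall (hΔ.image _) (hΔ.image _) fun a ha b hb => ?_
  obtain ⟨e, he, rfl⟩ := Finset.mem_image.1 ha
  obtain ⟨e', he', rfl⟩ := Finset.mem_image.1 hb
  show ‖x - y‖ - D ≤ ‖(e.1 - x) - (e'.1 - y)‖
  have h1 : ‖x - y‖ ≤ ‖(e.1 - x) - (e'.1 - y)‖ + ‖e.1 - e'.1‖ := by
    calc ‖x - y‖ = ‖(e.1 - e'.1) - ((e.1 - x) - (e'.1 - y))‖ := by congr 1; abel
      _ ≤ ‖e.1 - e'.1‖ + ‖(e.1 - x) - (e'.1 - y)‖ := norm_sub_le _ _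
      _ = _ := add_comm _ _
  linarith [hD e he e' he']

/-! ### Generic: uniform clustering of a kernel family ⇒ uniform block-variance ceiling -/

/-- **Two-translate covariance bound from uniform kernel clustering**: with the data of `kernel_variance_blockSum_le`,
`|cov_{γ Λ η}(F∘θ_x, F∘θ_y)| ≤ A · #Δ² · K² · e^{mD} · (e^{−m/d})^{‖x − y‖₁}` for all `Λ`, `η`, `x`, `y`. [folklore] -/
theorem kernel_abs_cov_shift_le (hd : 1 ≤ d)
    {γ : Finset (ZdEdge d) → LGConfig d (Matrix.specialUnitaryGroup (Fin N) ℂ) →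
      Measure (LGConfig d (Matrix.specialUnitaryGroup (Fin N) ℂ))}
    {A m : ℝ} (hA : 0 ≤ A) (hm : 0 < m)
    (hclus : ∀ Λ η (F₁ F₂ : LGConfig d (Matrix.specialUnitaryGroup (Fin N) ℂ) → ℝ) (Λ₁ Λ₂ : Finset (ZdEdge d))
      (K₁ K₂ : ℝ≥0), IsLipschitzCylinder (fundamentalRep (Fin N)) F₁ Λ₁ K₁ →
      IsLipschitzCylinder (fundamentalRep (Fin N)) F₂ Λ₂ K₂ →
        |cov[F₁, F₂; γ Λ η]| ≤ A * Λ₁.card * Λ₂.card * ((K₁ : ℝ) * K₂) * exp (-m * setDistEdges Λ₁ Λ₂))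
    {F : LGConfig d (Matrix.specialUnitaryGroup (Fin N) ℂ) → ℝ} {Δ : Finset (ZdEdge d)} {K : ℝ≥0}
    (hF : IsLipschitzCylinder (fundamentalRep (Fin N)) F Δ K)
    {D : ℝ} (hD : ∀ e ∈ Δ, ∀ e' ∈ Δ, ‖e.1 - e'.1‖ ≤ D)
    (Λ : Finset (ZdEdge d)) (η : LGConfig d (Matrix.specialUnitaryGroup (Fin N) ℂ)) (x y : Site d) :
    |cov[fun U => F (configShift x U), fun U => F (configShift y U); γ Λ η]| ≤
      A * (Δ.card : ℝ) ^ 2 * (K : ℝ) ^ 2 * exp (m * D) * exp (-(m / d)) ^ l1 (x - y) := by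
  classical
  have hd0 : (0 : ℝ) < d := by exact_mod_cast hd
  set r : ℝ := exp (-(m / d)) with hr
  set W : Site d → LGConfig d (Matrix.specialUnitaryGroup (Fin N) ℂ) → ℝ := fun x U => F (configShift x U) with hW
  have hWlip : ∀ x : Site d, IsLipschitzCylinder (fundamentalRep (Fin N)) (W x) (Δ.image fun e => (e.1 - x, e.2)) K :=
    fun x => isLipschitzCylinder_comp_configShift hF x
  have hcard : ∀ x : Site d, ((Δ.image fun e => (e.1 - x, e.2)).card : ℝ) ≤ Δ.card := fun x => by
    exact_mod_cast Finset.card_image_le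
  show |cov[W x, W y; γ Λ η]| ≤ A * (Δ.card : ℝ) ^ 2 * (K : ℝ) ^ 2 * exp (m * D) * r ^ l1 (x - y)
  have h := hclus Λ η (W x) (W y) _ _ K K (hWlip x) (hWlip y)
  rcases Δ.eq_empty_or_nonempty with hΔ | hΔ
  · have h0 : ((Δ.image fun e => (e.1 - x, e.2)).card : ℝ) = 0 := by simp [hΔ]
    rw [h0] at h
    have : |cov[W x, W y; γ Λ η]| ≤ 0 := by simpa using h
    exact this.trans (by positivity)
  · have hsd := norm_sub_le_setDistEdges_shift hΔ hD x y
    have hexp : exp (-m * setDistEdges (Δ.image fun e => (e.1 - x, e.2)) (Δ.image fun e => (e.1 - y, e.2))) ≤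
        exp (m * D) * r ^ l1 (x - y) := by
      calc exp (-m * setDistEdges (Δ.image fun e => (e.1 - x, e.2)) (Δ.image fun e => (e.1 - y, e.2)))
          ≤ exp (-m * (‖x - y‖ - D)) := exp_le_exp.2 (by nlinarith)
        _ = exp (m * D) * exp (-m * ‖x - y‖) := by rw [← Real.exp_add]; congr 1; ring
        _ ≤ exp (m * D) * r ^ l1 (x - y) :=
            mul_le_mul_of_nonneg_left (exp_neg_norm_le_pow hd hm.le (x - y)) (exp_pos _).le
    calc |cov[W x, W y; γ Λ η]|
        ≤ A * ((Δ.image fun e => (e.1 - x, e.2)).card : ℝ) * ((Δ.image fun e => (e.1 - y, e.2)).card : ℝ) *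
            ((K : ℝ) * K) * exp (-m * setDistEdges (Δ.image fun e => (e.1 - x, e.2)) (Δ.image fun e => (e.1 - y, e.2))) := h
      _ ≤ A * (Δ.card : ℝ) * Δ.card * ((K : ℝ) * K) * (exp (m * D) * r ^ l1 (x - y)) := by
          have h1 : A * ((Δ.image fun e => (e.1 - x, e.2)).card : ℝ) * ((Δ.image fun e => (e.1 - y, e.2)).card : ℝ) *
              ((K : ℝ) * K) ≤ A * (Δ.card : ℝ) * Δ.card * ((K : ℝ) * K) :=
            mul_le_mul_of_nonneg_right
              (mul_le_mul (mul_le_mul_of_nonneg_left (hcard x) hA) (hcard y) (Nat.cast_nonneg _) (by positivity))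
              (by positivity)
          exact mul_le_mul h1 hexp (exp_pos _).le (by positivity)
      _ = A * (Δ.card : ℝ) ^ 2 * (K : ℝ) ^ 2 * exp (m * D) * r ^ l1 (x - y) := by ring

/-- **UNIFORM THERMODYNAMIC VARIANCE CEILING FOR BLOCK SUMS from uniform kernel clustering.** Let `γ Λ η` be probability measures
clustering uniformly in the Lipschitz-cylinder form with constants `A ≥ 0`, `m > 0` (`d ≥ 1`), and let `F` be a Lipschitz cylinder
observable (links `Δ`, constant `K`) with `|F| ≤ M` whose links have base points within sup-distance `D` of each other. Then with
`v = A · #Δ² · K² · e^{mD} · ((1 + e^{−m/d})/(1 − e^{−m/d}))^d`: for every `Λ`, `η`, every finite `B ⊆ ℤ^d`,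
`Σ_{y∈B} |cov_{γ Λ η}(F∘θ_x, F∘θ_y)| ≤ v` for every `x`, and `Var_{γ Λ η}(Σ_{x∈B} F∘θ_x) ≤ v · #B`. [folklore] -/
theorem kernel_variance_blockSum_le (hd : 1 ≤ d)
    {γ : Finset (ZdEdge d) → LGConfig d (Matrix.specialUnitaryGroup (Fin N) ℂ) →
      Measure (LGConfig d (Matrix.specialUnitaryGroup (Fin N) ℂ))}
    (hγ : ∀ Λ η, IsProbabilityMeasure (γ Λ η)) {A m : ℝ} (hA : 0 ≤ A) (hm : 0 < m)
    (hclus : ∀ Λ η (F₁ F₂ : LGConfig d (Matrix.specialUnitaryGroup (Fin N) ℂ) → ℝ) (Λ₁ Λ₂ : Finset (ZdEdge d))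
      (K₁ K₂ : ℝ≥0), IsLipschitzCylinder (fundamentalRep (Fin N)) F₁ Λ₁ K₁ →
      IsLipschitzCylinder (fundamentalRep (Fin N)) F₂ Λ₂ K₂ →
        |cov[F₁, F₂; γ Λ η]| ≤ A * Λ₁.card * Λ₂.card * ((K₁ : ℝ) * K₂) * exp (-m * setDistEdges Λ₁ Λ₂))
    {F : LGConfig d (Matrix.specialUnitaryGroup (Fin N) ℂ) → ℝ} {Δ : Finset (ZdEdge d)} {K : ℝ≥0}
    (hF : IsLipschitzCylinder (fundamentalRep (Fin N)) F Δ K) {M : ℝ} (hM : ∀ U, |F U| ≤ M)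
    {D : ℝ} (hD : ∀ e ∈ Δ, ∀ e' ∈ Δ, ‖e.1 - e'.1‖ ≤ D)
    (Λ : Finset (ZdEdge d)) (η : LGConfig d (Matrix.specialUnitaryGroup (Fin N) ℂ)) (B : Finset (Site d)) :
    (∀ x : Site d, ∑ y ∈ B, |cov[fun U => F (configShift x U), fun U => F (configShift y U); γ Λ η]| ≤
        A * (Δ.card : ℝ) ^ 2 * (K : ℝ) ^ 2 * exp (m * D) * ((1 + exp (-(m / d))) / (1 - exp (-(m / d)))) ^ d) ∧
    Var[fun U => ∑ x ∈ B, F (configShift x U); γ Λ η] ≤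
      A * (Δ.card : ℝ) ^ 2 * (K : ℝ) ^ 2 * exp (m * D) * ((1 + exp (-(m / d))) / (1 - exp (-(m / d)))) ^ d * B.card := by
  classical
  haveI : SecondCountableTopology (Matrix (Fin N) (Fin N) ℂ) :=
    inferInstanceAs (SecondCountableTopology (Fin N → Fin N → ℂ))
  haveI : SecondCountableTopology (Matrix.specialUnitaryGroup (Fin N) ℂ) :=
    Topology.IsEmbedding.subtypeVal.secondCountableTopology
  haveI := hγ Λ η
  have hd0 : (0 : ℝ) < d := by exact_mod_cast hd
  set r : ℝ := exp (-(m / d)) with hr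
  have hr0 : 0 ≤ r := (exp_pos _).le
  have hr1 : r < 1 := Real.exp_lt_one_iff.2 (by rw [neg_neg_iff_pos]; positivity)
  set W : Site d → LGConfig d (Matrix.specialUnitaryGroup (Fin N) ℂ) → ℝ := fun x U => F (configShift x U) with hW
  -- translates are Lipschitz cylinders on the translated supports
  have hWlip : ∀ x : Site d, IsLipschitzCylinder (fundamentalRep (Fin N)) (W x) (Δ.image fun e => (e.1 - x, e.2)) K :=
    fun x => isLipschitzCylinder_comp_configShift hF x
  -- the two-translate covariance bound
  set v₀ : ℝ := A * (Δ.card : ℝ) ^ 2 * (K : ℝ) ^ 2 * exp (m * D) with hv₀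
  have hv₀0 : 0 ≤ v₀ := by positivity
  have hcovxy : ∀ x y : Site d, |cov[W x, W y; γ Λ η]| ≤ v₀ * r ^ l1 (x - y) := fun x y =>
    kernel_abs_cov_shift_le hd hA hm hclus hF hD Λ η x y
  -- the row sum
  have hrow : ∀ x : Site d, ∑ y ∈ B, |cov[W x, W y; γ Λ η]| ≤ v₀ * ((1 + r) / (1 - r)) ^ d := by
    intro x
    calc ∑ y ∈ B, |cov[W x, W y; γ Λ η]| ≤ ∑ y ∈ B, v₀ * r ^ l1 (x - y) := Finset.sum_le_sum fun y _ => hcovxy x y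
      _ = v₀ * ∑ y ∈ B, r ^ l1 (x - y) := by rw [Finset.mul_sum]
      _ ≤ v₀ * ((1 + r) / (1 - r)) ^ d := mul_le_mul_of_nonneg_left (sum_pow_l1_sub_le hr0 hr1 x B) hv₀0
  refine ⟨fun x => by simpa only [hv₀, hr] using hrow x, ?_⟩
  -- the variance as a double covariance sum
  have hWm : ∀ x : Site d, MemLp (W x) 2 (γ Λ η) := fun x =>
    memLp_of_bounded (a := -M) (b := M)
      (ae_of_all _ fun U => by simp only [Set.mem_Icc]; exact abs_le.1 (hM _))
      (hWlip x).measurable.aestronglyMeasurable 2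
  have hvar : Var[fun U => ∑ x ∈ B, W x U; γ Λ η] = ∑ x ∈ B, ∑ y ∈ B, cov[W x, W y; γ Λ η] := by
    have hsum : (fun U => ∑ x ∈ B, W x U) = ∑ x ∈ B, W x := by funext U; simp
    rw [hsum, ← covariance_self (memLp_finsetSum' B fun x _ => hWm x).aestronglyMeasurable.aemeasurable,
      covariance_sum_sum' (fun x _ => hWm x) (fun y _ => hWm y)]
  show Var[fun U => ∑ x ∈ B, W x U; γ Λ η] ≤ _
  rw [hvar]
  calc ∑ x ∈ B, ∑ y ∈ B, cov[W x, W y; γ Λ η] ≤ ∑ x ∈ B, ∑ y ∈ B, |cov[W x, W y; γ Λ η]| :=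
        Finset.sum_le_sum fun x _ => Finset.sum_le_sum fun y _ => le_abs_self _
    _ ≤ ∑ _x ∈ B, v₀ * ((1 + r) / (1 - r)) ^ d := Finset.sum_le_sum fun x _ => hrow x
    _ = v₀ * ((1 + r) / (1 - r)) ^ d * B.card := by rw [Finset.sum_const, nsmul_eq_mul, mul_comm]

/-! ### The tier-1 ball through any robust single-link door -/

/-- **UNIFORM BLOCK-VARIANCE CEILING ON THE TIER-1 BALL from ANY robust single-link door**: under the hypotheses of
`kernel_covariance_decay_of_isKRContraction` (rows `≤ ρ < 1`, range `R`; `d ≥ 1`), for every Lipschitz cylinder `F` (links `Δ`, constant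
`K`, `|F| ≤ M`, base points within `D` of each other) there is ONE `v` with `Var_{γ^W_Λ(·|η)}(Σ_{x∈B} F∘θ_x) ≤ v · #B` for EVERY finite
link volume `Λ`, EVERY boundary field `η` and every finite block `B ⊆ ℤ^d`. [folklore] -/
theorem kernel_blockVariance_of_isKRContraction (hd : 1 ≤ d) {β ρ R : ℝ}
    {W : Potential (ZdEdge d) (Matrix.specialUnitaryGroup (Fin N) ℂ)} (hW : W.IsAdapted)
    (hWb : ∀ X, ∃ C, ∀ U, |W X U| ≤ C)
    {supp : Finset (ZdEdge d) → Finset (Finset (ZdEdge d))} (hsupp : W.IsSupportedBy supp)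
    {C : ZdEdge d → ZdEdge d → ℝ}
    (hKR : IsKRContraction (perturbedYM (d := d) (fundamentalRep (Fin N)) (N * β) W supp) suFrobDist
      (perturbedNbr supp) C)
    (hrow : ∀ x, ∑ y ∈ perturbedNbr supp x, C x y ≤ ρ) (hρ : ρ < 1)
    (hR : ∀ e, ∀ X ∈ supp {e}, e ∈ X → ∀ y ∈ X, ‖e.1 - y.1‖ ≤ R)
    {F : LGConfig d (Matrix.specialUnitaryGroup (Fin N) ℂ) → ℝ} {Δ : Finset (ZdEdge d)} {K : ℝ≥0}
    (hF : IsLipschitzCylinder (fundamentalRep (Fin N)) F Δ K) {M : ℝ} (hM : ∀ U, |F U| ≤ M)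
    {D : ℝ} (hD : ∀ e ∈ Δ, ∀ e' ∈ Δ, ‖e.1 - e'.1‖ ≤ D) :
    ∃ v : ℝ, ∀ (Λ : Finset (ZdEdge d)) (η : LGConfig d (Matrix.specialUnitaryGroup (Fin N) ℂ)) (B : Finset (Site d)),
      Var[fun U => ∑ x ∈ B, F (configShift x U); perturbedYM (d := d) (fundamentalRep (Fin N)) (N * β) W supp Λ η] ≤
        v * B.card := by
  haveI : SecondCountableTopology (Matrix (Fin N) (Fin N) ℂ) :=
    inferInstanceAs (SecondCountableTopology (Fin N → Fin N → ℂ))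
  haveI : SecondCountableTopology (Matrix.specialUnitaryGroup (Fin N) ℂ) :=
    Topology.IsEmbedding.subtypeVal.secondCountableTopology
  have hγ : IsSpecification (perturbedYM (d := d) (fundamentalRep (Fin N)) (N * β) W supp) :=
    isSpecification_perturbedYM _ (continuous_fundamentalRep (Fin N)) _ hW hWb hsupp
  have hc'0 : 0 < max ρ (1 / 2) := lt_max_of_lt_right (by norm_num)
  have hc'1 : max ρ (1 / 2) < 1 := max_lt hρ (by norm_num)
  have hκ0 : 0 < -Real.log (max ρ (1 / 2)) := neg_pos.2 (Real.log_neg hc'0 hc'1)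
  have hR₀0 : 0 < max 1 R := zero_lt_one.trans_le (le_max_left _ _)
  set A : ℝ := 2 * (2 * Real.sqrt N) ^ 2 * exp (-Real.log (max ρ (1 / 2))) with hA
  have hA0 : 0 ≤ A := by positivity
  have hm : 0 < -Real.log (max ρ (1 / 2)) / max 1 R := div_pos hκ0 hR₀0
  have hclus : ∀ Λ η (F₁ F₂ : LGConfig d (Matrix.specialUnitaryGroup (Fin N) ℂ) → ℝ) (Λ₁ Λ₂ : Finset (ZdEdge d))
      (K₁ K₂ : ℝ≥0), IsLipschitzCylinder (fundamentalRep (Fin N)) F₁ Λ₁ K₁ →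
      IsLipschitzCylinder (fundamentalRep (Fin N)) F₂ Λ₂ K₂ →
        |cov[F₁, F₂; perturbedYM (d := d) (fundamentalRep (Fin N)) (N * β) W supp Λ η]| ≤
          A * Λ₁.card * Λ₂.card * ((K₁ : ℝ) * K₂) *
            exp (-(-Real.log (max ρ (1 / 2)) / max 1 R) * setDistEdges Λ₁ Λ₂) := by
    intro Λ η F₁ F₂ Λ₁ Λ₂ K₁ K₂ hF₁ hF₂
    have h := kernel_covariance_decay_of_isKRContraction hW hWb hsupp hKR hrow hρ hR Λ η hF₁ hF₂
    refine h.trans (le_of_eq ?_)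
    simp only [hA]
    ring
  exact ⟨_, fun Λ η B =>
    (kernel_variance_blockSum_le hd (fun Λ η => hγ.isProbability Λ η) hA0 hm hclus hF hM hD Λ η B).2⟩

/-! ### The Wilson point -/

/-- **THE WILSON POINT, BLOCK VARIANCE OF ANY LOCAL OBSERVABLE**: `SU(2)` on `ℤ⁴`, `0 ≤ β_W ≤ 1/12` (tree coupling `β_W/2`): for every
Lipschitz cylinder observable `F` (links `Δ`, constant `K`, `|F| ≤ M`, base points within `D` of each other), EVERY finite link
volume `Λ`, EVERY boundary field `η` and every finite block `B ⊆ ℤ⁴`: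
`Var_{γ_Λ(·|η)}(Σ_{x∈B} F∘θ_x) ≤ 32 · #Δ² · K² · e^{(log 2)D} · ((1 + e^{−(log 2)/4})/(1 − e^{−(log 2)/4}))⁴ · #B` — one explicit variance
density for all volumes, boundary fields and blocks. [folklore] -/
theorem su2_wilson_kernel_blockVariance_upTo_oneTwelfth {βW : ℝ} (h0 : 0 ≤ βW) (h : βW ≤ 1 / 12)
    {F : LGConfig 4 (Matrix.specialUnitaryGroup (Fin 2) ℂ) → ℝ} {Δ : Finset (ZdEdge 4)} {K : ℝ≥0}
    (hF : IsLipschitzCylinder (fundamentalRep (Fin 2)) F Δ K) {M : ℝ} (hM : ∀ U, |F U| ≤ M)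
    {D : ℝ} (hD : ∀ e ∈ Δ, ∀ e' ∈ Δ, ‖e.1 - e'.1‖ ≤ D)
    (Λ : Finset (ZdEdge 4)) (η : LGConfig 4 (Matrix.specialUnitaryGroup (Fin 2) ℂ)) (B : Finset (Site 4)) :
    Var[fun U => ∑ x ∈ B, F (configShift x U); ymSpecification (d := 4) (fundamentalRep (Fin 2)) (βW / 2) Λ η] ≤
      32 * (Δ.card : ℝ) ^ 2 * (K : ℝ) ^ 2 * exp (Real.log 2 * D) *
        ((1 + exp (-(Real.log 2 / (4 : ℕ)))) / (1 - exp (-(Real.log 2 / (4 : ℕ))))) ^ (4 : ℕ) * B.card :=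
  (kernel_variance_blockSum_le (d := 4) (N := 2) (by norm_num)
    (fun Λ η => isProbabilityMeasure_ymSpecification _ (continuous_fundamentalRep (Fin 2)) _ Λ η)
    (A := 32) (m := Real.log 2) (by norm_num) (Real.log_pos (by norm_num))
    (fun Λ η F₁ F₂ Λ₁ Λ₂ K₁ K₂ hF₁ hF₂ => su2_wilson_kernel_clustering_upTo_oneTwelfth h0 h Λ η hF₁ hF₂)
    hF hM hD Λ η B).2


/-- ★ **THE WILSON POINT, BLOCK VARIANCE OF WILSON LOOPS**: `SU(2)` on `ℤ⁴`, `0 ≤ β_W ≤ 1/12`: for every coupling `c`, every closed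
lattice walk `γ` (loop term `c · Re tr U_γ / 2`), EVERY finite link volume `Λ`, EVERY boundary field `η` and every finite block `B ⊆ ℤ⁴`:
`Var_{γ_Λ(·|η)}(Σ_{x∈B} (c W_γ)∘θ_x) ≤ 64·c²·|γ|⁴·4^{|γ|}·((1+e^{−(log 2)/4})/(1−e^{−(log 2)/4}))⁴·#B` (links of `γ` have base-point spread
`≤ 2|γ|`, the tree's `norm_sub_le_two_mul_length_of_mem_walkEdges`; no optimisation of the loop-size dependence attempted). [folklore] -/
theorem su2_wilson_kernel_loop_blockVariance_upTo_oneTwelfth {βW : ℝ} (h0 : 0 ≤ βW) (h : βW ≤ 1 / 12)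
    (c : ℝ) {x₀ : Site 4} (w : (zdGraph 4).Walk x₀ x₀)
    (Λ : Finset (ZdEdge 4)) (η : LGConfig 4 (Matrix.specialUnitaryGroup (Fin 2) ℂ)) (B : Finset (Site 4)) :
    Var[fun U => ∑ x ∈ B, loopTerm 2 c w (configShift x U); ymSpecification (d := 4) (fundamentalRep (Fin 2)) (βW / 2) Λ η] ≤
      64 * c ^ 2 * (w.length : ℝ) ^ 4 * exp (Real.log 2 * (2 * w.length)) *
        ((1 + exp (-(Real.log 2 / (4 : ℕ)))) / (1 - exp (-(Real.log 2 / (4 : ℕ))))) ^ (4 : ℕ) * B.card := by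
  have h1 := su2_wilson_kernel_blockVariance_upTo_oneTwelfth h0 h (isLipschitzCylinder_loopTerm (N := 2) c w)
    (fun U => abs_loopTerm_le w U) (fun e he e' he' => norm_sub_le_two_mul_length_of_mem_walkEdges w he he') Λ η B
  refine h1.trans ?_
  have hcard : ((walkEdges w).card : ℝ) ≤ w.length := by exact_mod_cast card_walkEdges_le_length w
  have hsq : Real.sqrt ((2 : ℕ) : ℝ) ^ 2 = 2 := by rw [Real.sq_sqrt (by norm_num)]; norm_num
  have hG : 0 ≤ exp (Real.log 2 * (2 * w.length)) *
      ((1 + exp (-(Real.log 2 / (4 : ℕ)))) / (1 - exp (-(Real.log 2 / (4 : ℕ))))) ^ (4 : ℕ) * (B.card : ℝ) := by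
    have hr1 : exp (-(Real.log 2 / (4 : ℕ))) < 1 := Real.exp_lt_one_iff.2 (by
      rw [neg_neg_iff_pos]; exact div_pos (Real.log_pos (by norm_num)) (by norm_num))
    have : 0 ≤ (1 + exp (-(Real.log 2 / (4 : ℕ)))) / (1 - exp (-(Real.log 2 / (4 : ℕ)))) :=
      div_nonneg (by positivity) (by linarith)
    positivity
  have hK : (((⟨|c| * Real.sqrt (2 : ℕ) * w.length, by positivity⟩ : ℝ≥0) : ℝ)) ^ 2 = 2 * c ^ 2 * (w.length : ℝ) ^ 2 := by
    have e : (((⟨|c| * Real.sqrt (2 : ℕ) * w.length, by positivity⟩ : ℝ≥0) : ℝ)) = |c| * Real.sqrt (2 : ℕ) * w.length := rfl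
    rw [e, mul_pow, mul_pow, hsq, sq_abs]; ring
  calc 32 * ((walkEdges w).card : ℝ) ^ 2 * (((⟨|c| * Real.sqrt (2 : ℕ) * w.length, by positivity⟩ : ℝ≥0) : ℝ)) ^ 2 *
        exp (Real.log 2 * (2 * w.length)) * ((1 + exp (-(Real.log 2 / (4 : ℕ)))) / (1 - exp (-(Real.log 2 / (4 : ℕ))))) ^ (4 : ℕ) *
          B.card
      = (32 * ((walkEdges w).card : ℝ) ^ 2 * (2 * c ^ 2 * (w.length : ℝ) ^ 2)) *
          (exp (Real.log 2 * (2 * w.length)) * ((1 + exp (-(Real.log 2 / (4 : ℕ)))) / (1 - exp (-(Real.log 2 / (4 : ℕ))))) ^ (4 : ℕ) *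
            (B.card : ℝ)) := by rw [hK]; ring
    _ ≤ (32 * (w.length : ℝ) ^ 2 * (2 * c ^ 2 * (w.length : ℝ) ^ 2)) *
          (exp (Real.log 2 * (2 * w.length)) * ((1 + exp (-(Real.log 2 / (4 : ℕ)))) / (1 - exp (-(Real.log 2 / (4 : ℕ))))) ^ (4 : ℕ) *
            (B.card : ℝ)) := by
        refine mul_le_mul_of_nonneg_right ?_ hG
        have : ((walkEdges w).card : ℝ) ^ 2 ≤ (w.length : ℝ) ^ 2 := pow_le_pow_left₀ (Nat.cast_nonneg _) hcard 2
        nlinarith [sq_nonneg c, sq_nonneg (w.length : ℝ)]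
    _ = _ := by ring

/-! ### The thermodynamic limit of the finite-volume susceptibility of any local observable, any boundary -/

/-- **GENERIC THERMODYNAMIC LIMIT OF THE SUSCEPTIBILITY OF A LOCAL OBSERVABLE**: let the kernel family `γ Λ η` cluster uniformly in the
Lipschitz-cylinder form (`A ≥ 0`, `m > 0`, `d ≥ 1`) and let `μ` be a probability measure with `∫ G dγ_{Λ_n}(·|η_n) → ∫ G dμ` for every
bounded continuous `G` along some sequence `(Λ_n, η_n)` (the cell's boundary-limit theorem). Then for every Lipschitz cylinder `F` (links `Δ`,
constant `K`, `|F| ≤ M`, base-point spread `≤ D`) and every `x`: `Σ_y cov_{γ_{Λ_n}(·|η_n)}(F∘θ_x, F∘θ_y) → Σ_y cov_μ(F∘θ_x, F∘θ_y)` (Tannery's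
theorem; the two-translate bound `kernel_abs_cov_shift_le` is the uniform summable majorant). [folklore] -/
theorem tendsto_tsum_cov_shift_of_clustering (hd : 1 ≤ d)
    {γ : Finset (ZdEdge d) → LGConfig d (Matrix.specialUnitaryGroup (Fin N) ℂ) →
      Measure (LGConfig d (Matrix.specialUnitaryGroup (Fin N) ℂ))}
    (hγ : ∀ Λ η, IsProbabilityMeasure (γ Λ η)) {A m : ℝ} (hA : 0 ≤ A) (hm : 0 < m)
    (hclus : ∀ Λ η (F₁ F₂ : LGConfig d (Matrix.specialUnitaryGroup (Fin N) ℂ) → ℝ) (Λ₁ Λ₂ : Finset (ZdEdge d))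
      (K₁ K₂ : ℝ≥0), IsLipschitzCylinder (fundamentalRep (Fin N)) F₁ Λ₁ K₁ →
      IsLipschitzCylinder (fundamentalRep (Fin N)) F₂ Λ₂ K₂ →
        |cov[F₁, F₂; γ Λ η]| ≤ A * Λ₁.card * Λ₂.card * ((K₁ : ℝ) * K₂) * exp (-m * setDistEdges Λ₁ Λ₂))
    {μ : Measure (LGConfig d (Matrix.specialUnitaryGroup (Fin N) ℂ))} [IsProbabilityMeasure μ]
    {Λs : ℕ → Finset (ZdEdge d)} {ηs : ℕ → LGConfig d (Matrix.specialUnitaryGroup (Fin N) ℂ)}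
    (hlim : ∀ G : LGConfig d (Matrix.specialUnitaryGroup (Fin N) ℂ) → ℝ, Continuous G → (∃ C, ∀ U, |G U| ≤ C) →
      Tendsto (fun n => ∫ U, G U ∂(γ (Λs n) (ηs n))) atTop (𝓝 (∫ U, G U ∂μ)))
    {F : LGConfig d (Matrix.specialUnitaryGroup (Fin N) ℂ) → ℝ} {Δ : Finset (ZdEdge d)} {K : ℝ≥0}
    (hF : IsLipschitzCylinder (fundamentalRep (Fin N)) F Δ K) {M : ℝ} (hM : ∀ U, |F U| ≤ M)
    {D : ℝ} (hD : ∀ e ∈ Δ, ∀ e' ∈ Δ, ‖e.1 - e'.1‖ ≤ D) (x : Site d) :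
    Tendsto (fun n => ∑' y : Site d, cov[fun U => F (configShift x U), fun U => F (configShift y U); γ (Λs n) (ηs n)]) atTop
      (𝓝 (∑' y : Site d, cov[fun U => F (configShift x U), fun U => F (configShift y U); μ])) := by
  classical
  haveI : SecondCountableTopology (Matrix (Fin N) (Fin N) ℂ) :=
    inferInstanceAs (SecondCountableTopology (Fin N → Fin N → ℂ))
  haveI : SecondCountableTopology (Matrix.specialUnitaryGroup (Fin N) ℂ) :=
    Topology.IsEmbedding.subtypeVal.secondCountableTopology
  set W : Site d → LGConfig d (Matrix.specialUnitaryGroup (Fin N) ℂ) → ℝ := fun y U => F (configShift y U) with hW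
  have hWlip : ∀ y : Site d, IsLipschitzCylinder (fundamentalRep (Fin N)) (W y) (Δ.image fun e => (e.1 - y, e.2)) K :=
    fun y => isLipschitzCylinder_comp_configShift hF y
  have hWc : ∀ y : Site d, Continuous (W y) := fun y => continuous_of_isLipschitzCylinder (hWlip y)
  have hWb : ∀ (y : Site d) U, |W y U| ≤ M := fun y U => hM _
  have hM0 : 0 ≤ M := (abs_nonneg _).trans (hM 1)
  have hWmem : ∀ (y : Site d) (ν : Measure (LGConfig d (Matrix.specialUnitaryGroup (Fin N) ℂ))) [IsProbabilityMeasure ν],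
      MemLp (W y) 2 ν := fun y ν _ =>
    memLp_of_bounded (a := -M) (b := M) (ae_of_all _ fun U => by simp only [Set.mem_Icc]; exact abs_le.1 (hWb y U))
      (hWc y).measurable.aestronglyMeasurable 2
  -- termwise convergence: `cov = ∫ W_x W_y − ∫ W_x ∫ W_y`, each integral converges
  have hterm : ∀ y : Site d, Tendsto (fun n => cov[W x, W y; γ (Λs n) (ηs n)]) atTop (𝓝 (cov[W x, W y; μ])) := by
    intro y
    haveI := fun n => hγ (Λs n) (ηs n)
    have h1 := hlim (fun U => W x U * W y U) ((hWc x).mul (hWc y))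
      ⟨M * M, fun U => by rw [abs_mul]; exact mul_le_mul (hWb x U) (hWb y U) (abs_nonneg _) hM0⟩
    have h2 := hlim (W x) (hWc x) ⟨M, hWb x⟩
    have h3 := hlim (W y) (hWc y) ⟨M, hWb y⟩
    have hcovn : ∀ n, cov[W x, W y; γ (Λs n) (ηs n)] =
        (∫ U, W x U * W y U ∂(γ (Λs n) (ηs n))) - (∫ U, W x U ∂(γ (Λs n) (ηs n))) * ∫ U, W y U ∂(γ (Λs n) (ηs n)) :=
      fun n => covariance_eq_sub (hWmem x _) (hWmem y _)
    have hcovμ : cov[W x, W y; μ] = (∫ U, W x U * W y U ∂μ) - (∫ U, W x U ∂μ) * ∫ U, W y U ∂μ :=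
      covariance_eq_sub (hWmem x _) (hWmem y _)
    rw [show (fun n => cov[W x, W y; γ (Λs n) (ηs n)]) = fun n =>
        (∫ U, W x U * W y U ∂(γ (Λs n) (ηs n))) - (∫ U, W x U ∂(γ (Λs n) (ηs n))) * ∫ U, W y U ∂(γ (Λs n) (ηs n))
        from funext hcovn, hcovμ]
    exact h1.sub (h2.mul h3)
  -- uniform summable majorant from the two-translate bound
  have hd0 : (0 : ℝ) < d := by exact_mod_cast hd
  set r : ℝ := exp (-(m / d)) with hr
  have hr0 : 0 ≤ r := (exp_pos _).le
  have hr1 : r < 1 := Real.exp_lt_one_iff.2 (by rw [neg_neg_iff_pos]; positivity)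
  set v₀ : ℝ := A * (Δ.card : ℝ) ^ 2 * (K : ℝ) ^ 2 * exp (m * D) with hv₀
  have hbound : ∀ (n : ℕ) (y : Site d), ‖cov[W x, W y; γ (Λs n) (ηs n)]‖ ≤ v₀ * r ^ l1 (x - y) := by
    intro n y
    rw [Real.norm_eq_abs]
    exact kernel_abs_cov_shift_le hd hA hm hclus hF hD (Λs n) (ηs n) x y
  have hsumb : Summable fun y : Site d => v₀ * r ^ l1 (x - y) := (summable_pow_l1_sub hr0 hr1 x).1.mul_left v₀
  exact tendsto_tsum_of_dominated_convergence hsumb hterm (Eventually.of_forall fun n y => hbound n y)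

/-- ★★ **THE FINITE-VOLUME SUSCEPTIBILITY OF ANY LOCAL LIPSCHITZ OBSERVABLE, WITH ANY BOUNDARY FIELD, CONVERGES TO THE INFINITE-VOLUME
ONE** (`SU(2)`, `ℤ⁴`, `0 ≤ β_W ≤ 1/12`, tree coupling `β_W/2`): the DLR states form a singleton `{μ}` and for every Lipschitz cylinder `F`
(links `Δ`, constant `K`, `|F| ≤ M`, base-point spread `≤ D`), every exhausting sequence of finite link volumes `Λ_n`, every sequence of boundary
fields `η_n` and every `x ∈ ℤ⁴`: `Σ_y cov_{γ_{Λ_n}(·|η_n)}(F∘θ_x, F∘θ_y) → Σ_y cov_μ(F∘θ_x, F∘θ_y)` (sums over all `y ∈ ℤ⁴`;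
`tendsto_tsum_cov_shift_of_clustering` with the Wilson-point kernel clustering and the cell's boundary-limit theorem). [folklore] -/
theorem su2_wilson_kernel_observable_susceptibility_tendsto {βW : ℝ} (h0 : 0 ≤ βW) (h : βW ≤ 1 / 12) :
    ∃ μ : Measure (LGConfig 4 (Matrix.specialUnitaryGroup (Fin 2) ℂ)),
      ymGibbsMeasures (d := 4) (fundamentalRep (Fin 2)) (βW / 2) = {μ} ∧
      ∀ {F : LGConfig 4 (Matrix.specialUnitaryGroup (Fin 2) ℂ) → ℝ} {Δ : Finset (ZdEdge 4)} {K : ℝ≥0},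
        IsLipschitzCylinder (fundamentalRep (Fin 2)) F Δ K → ∀ {M : ℝ}, (∀ U, |F U| ≤ M) →
        ∀ {D : ℝ}, (∀ e ∈ Δ, ∀ e' ∈ Δ, ‖e.1 - e'.1‖ ≤ D) →
        ∀ (Λs : ℕ → Finset (ZdEdge 4)), (∀ Δ' : Finset (ZdEdge 4), ∀ᶠ n in atTop, Δ' ⊆ Λs n) →
        ∀ (ηs : ℕ → LGConfig 4 (Matrix.specialUnitaryGroup (Fin 2) ℂ)) (x : Site 4),
          Tendsto (fun n => ∑' y : Site 4, cov[fun U => F (configShift x U), fun U => F (configShift y U);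
              ymSpecification (d := 4) (fundamentalRep (Fin 2)) (βW / 2) (Λs n) (ηs n)]) atTop
            (𝓝 (∑' y : Site 4, cov[fun U => F (configShift x U), fun U => F (configShift y U); μ])) := by
  have hβ : |βW / 4| ≤ 9 / 100 := by rw [abs_of_nonneg (by linarith)]; linarith
  obtain ⟨μ, hG, hlim⟩ := boundaryLimit_of_massGapAt (d := 4) (ImprovedThresholdStar.su2_massGapAt_of_abs_le hβ)
  have e2 : (((2 : ℕ) : ℝ) * (βW / 4) : ℝ) = βW / 2 := by push_cast; ring
  rw [e2] at hG hlim
  have hμ : μ ∈ ymGibbsMeasures (d := 4) (fundamentalRep (Fin 2)) (βW / 2) := by rw [hG]; exact Set.mem_singleton μ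
  haveI := (show IsGibbsMeasure _ μ from hμ).isProbabilityMeasure
  refine ⟨μ, hG, fun {F} {Δ} {K} hF {M} hM {D} hD Λs hcof ηs x => ?_⟩
  obtain ⟨hFlim, -⟩ := hlim Λs hcof
  exact tendsto_tsum_cov_shift_of_clustering (d := 4) (N := 2) (by norm_num)
    (fun Λ η => isProbabilityMeasure_ymSpecification _ (continuous_fundamentalRep (Fin 2)) _ Λ η)
    (A := 32) (m := Real.log 2) (by norm_num) (Real.log_pos (by norm_num))
    (fun Λ η F₁ F₂ Λ₁ Λ₂ K₁ K₂ hF₁ hF₂ => su2_wilson_kernel_clustering_upTo_oneTwelfth h0 h Λ η hF₁ hF₂)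
    (fun G hGc hGb => hFlim ηs G hGc hGb) hF hM hD x

end KernelBlockVariance

end Summit.Ventures.YMGap.RobustBall

end
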